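import Mathlib.Algebra.BigOperators.Fin
import Mathlib.Data.Fintype.BigOperators
import Mathlib.Data.Fintype.Card
import Literature.Computability.Complexity.Circuit
import HarnessLib

/-!
# Composition of straight-line circuits and the trivial universal size bound (trunk CplxCore)

Infrastructure for building the straight-line `B₂`-circuits of
`Literature.Computability.Complexity.Circuit` compositionally, as needed for the simulation of
Turing machines by circuit families (`P ⊆ P/poly`, Arora–Barak 2009, Thm. 6.6).

A `Circuit ι` is a list of gates (a straight-line program, Arora–Barak 2009, Rem. 6.4) with a
single output wire. Here we work with *multi-output* straight-line programs: a gate list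
`gs : List (Gate ι)` together with a family of output wires `out : κ → ι ⊕ ℕ`; such a pair
*realizes* a multi-output Boolean map `f : (ι → Bool) → (κ → Bool)` (`GateList.Realizes`), and
`CktSize B f s` says that `f` is realized by some gate list over the basis `B` with at most `s`
gates. We prove the standard closure properties:

* `CktSize.comp`: sequential composition, sizes add (Vollmer 1999, §1.2; Arora–Barak 2009,
  proof of Thm. 6.6, "the composition of all these circuits");
* `CktSize.pair`, `CktSize.pi`: parallel composition (bundling outputs), sizes add;
* `CktSize.rewire`, `CktSize.outMap`: renaming input variables / output wires is free;
* `CktSize.gate`, `cktSize_const`, `cktSize_proj`: single gates, constants, projections;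
* `cktSize_univ`: every Boolean function of `m` variables has a `B₂`-circuit of size
  `≤ univBound m = 5 · 2 ^ m - 4` (Shannon expansion `f = (x₀ ∧ f|₁) ∨ (¬x₀ ∧ f|₀)`; Arora–Barak
  2009, Claim 2.13 / Exercise 6.1 give the sharper `O(2ᵐ / m)`-free bound `O(m 2ᵐ)` via CNF, any
  bound depending only on `m` suffices downstream);
* `CktSize.toCircuit`: a single-output realization yields a genuine `Circuit ι` over `B` of
  size `≤ s` computing `f`;
* `CktSize.iterate`: `t`-fold iteration of an endo-map costs `t * s` gates.

Sources: H. Vollmer, *Introduction to Circuit Complexity* (1999), §1.2 (composition and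
projection closure of circuit size); S. Arora, B. Barak, *Computational Complexity: A Modern
Approach* (2009), Def. 6.1, Rem. 6.4, Claim 2.13, Thm. 6.6.

Mathlib has no Boolean circuits; everything is in `namespace Literature.CplxCore` on top of the H21
`Circuit`/`Gate`/`B2` of `Literature.Computability.Complexity.Circuit`.

Design: the technical heart is `GateList.vals_append_reloc`: appending to a gate list `gs` a
second gate list `gs'` whose input variables are re-wired to wires of `gs` (`GateList.reloc`)
evaluates `gs'` on the values of those wires. All statements are over an arbitrary basis
`B : Set GateFn` except the universal bound and the concrete gates, which are over `B2`.
-/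

namespace Literature.Computability.Complexity

open Finset

variable {ι ι' κ κ' μ : Type*}

namespace GateList

/-! ### Evaluation of gate lists -/

/-- The value carried by a wire, given the input assignment `x` and the list `vs` of the values
of the gates computed so far: an input wire `inl i` carries `x i`, a gate wire `inr m` carries
`vs[m]` (junk `false` out of range) (Arora–Barak 2009, Rem. 6.4). [cite: AroraBarakCC2009, Rem. 6.4] -/
def wireOf (x : ι → Bool) (vs : List Bool) : ι ⊕ ℕ → Bool
  | .inl i => x i
  | .inr m => vs.getD m false

/-- An input wire carries the input bit (definitional). [folklore] -/
@[simp] theorem wireOf_inl (x : ι → Bool) (vs : List Bool) (i : ι) :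
    wireOf x vs (.inl i) = x i := rfl

/-- A gate wire carries the recorded gate value (definitional). [folklore] -/
@[simp] theorem wireOf_inr (x : ι → Bool) (vs : List Bool) (m : ℕ) :
    wireOf x vs (.inr m) = vs.getD m false := rfl

/-- The values of all gates of the straight-line program `gs` on input `x`, in program order
(this is `Circuit.wireVals` for a bare gate list; Arora–Barak 2009, Rem. 6.4). [cite: AroraBarakCC2009, Rem. 6.4] -/
def vals (gs : List (Gate ι)) (x : ι → Bool) : List Bool :=
  gs.foldl (fun vs g => vs ++ [g.op fun a => wireOf x vs (g.args a)]) []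

/-- `Circuit.wireVals` is `GateList.vals` of the gate list (definitional). [folklore] -/
theorem circuit_wireVals (C : Circuit ι) (x : ι → Bool) : C.wireVals x = vals C.gates x := rfl

/-- The empty program has no gate values. [folklore] -/
@[simp] theorem vals_nil (x : ι → Bool) : vals ([] : List (Gate ι)) x = [] := rfl

/-- Evaluating one more gate appends its value. [folklore] -/
theorem vals_append_singleton (gs : List (Gate ι)) (g : Gate ι) (x : ι → Bool) :
    vals (gs ++ [g]) x = vals gs x ++ [g.op fun a => wireOf x (vals gs x) (g.args a)] := by
  simp [vals, List.foldl_append]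

/-- A gate list with `L` gates has `L` gate values. [folklore] -/
@[simp] theorem length_vals (gs : List (Gate ι)) (x : ι → Bool) :
    (vals gs x).length = gs.length := by
  induction gs using List.reverseRecOn with
  | nil => rfl
  | append_singleton gs g ih => simp [vals_append_singleton, ih]

/-- Gate values are stable under appending further gates. [folklore] -/
theorem vals_append_take (gs gs' : List (Gate ι)) (x : ι → Bool) :
    ∃ ws, vals (gs ++ gs') x = vals gs x ++ ws := by
  induction gs' using List.reverseRecOn with
  | nil => exact ⟨[], by simp⟩
  | append_singleton gs' g ih =>
    obtain ⟨ws, hws⟩ := ih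
    exact ⟨ws ++ [g.op fun a => wireOf x (vals (gs ++ gs') x) (g.args a)], by
      rw [← List.append_assoc, vals_append_singleton, hws, List.append_assoc]⟩

/-! ### Well-formedness -/

/-- The gate `g`, placed at position `n` of a program, only reads gates at positions `< n`
(Arora–Barak 2009, Rem. 6.4). [cite: AroraBarakCC2009, Rem. 6.4] -/
def GateOK (n : ℕ) (g : Gate ι) : Prop := ∀ a m, g.args a = .inr m → m < n

/-- A gate list is well formed (acyclic) if every gate only reads earlier gates; this is the
list form of `Circuit.wf` (Arora–Barak 2009, Rem. 6.4). [cite: AroraBarakCC2009, Rem. 6.4] -/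
def WF (gs : List (Gate ι)) : Prop := ∀ (j : ℕ) (g : Gate ι), gs[j]? = some g → GateOK j g

/-- A gate valid at position `n` is valid at any later position. [folklore] -/
theorem GateOK.mono {n n' : ℕ} {g : Gate ι} (h : GateOK n g) (hn : n ≤ n') : GateOK n' g :=
  fun a m ha => (h a m ha).trans_le hn

/-- The empty program is well formed. [folklore] -/
theorem WF.nil : WF ([] : List (Gate ι)) := fun j g h => by simp at h

/-- Appending gates that only read earlier positions keeps a program well formed. [folklore] -/
theorem WF.append {gs gs' : List (Gate ι)} (h : WF gs)
    (h' : ∀ (j : ℕ) (g : Gate ι), gs'[j]? = some g → GateOK (gs.length + j) g) :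
    WF (gs ++ gs') := by
  intro j g hj
  by_cases hjl : j < gs.length
  · rw [List.getElem?_append_left hjl] at hj
    exact h j g hj
  · rw [List.getElem?_append_right (not_lt.1 hjl)] at hj
    have := h' _ _ hj
    rwa [Nat.add_sub_cancel' (not_lt.1 hjl)] at this

/-- A prefix of a well-formed program is well formed. [folklore] -/
theorem WF.of_append_left {gs gs' : List (Gate ι)} (h : WF (gs ++ gs')) : WF gs :=
  fun j g hj => h j g (by
    rw [List.getElem?_append_left (List.getElem?_eq_some_iff.1 hj).1]; exact hj)

/-- The last gate of a well-formed program only reads earlier gates. [folklore] -/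
theorem WF.getLast {gs : List (Gate ι)} {g : Gate ι} (h : WF (gs ++ [g])) :
    GateOK gs.length g :=
  h _ _ (by simp)

/-- Appending one valid gate keeps a program well formed. [folklore] -/
theorem WF.append_singleton {gs : List (Gate ι)} {g : Gate ι} (h : WF gs)
    (hg : GateOK gs.length g) : WF (gs ++ [g]) :=
  h.append fun j g' hj => by
    obtain ⟨rfl, rfl⟩ : j = 0 ∧ g = g' := by simpa [List.getElem?_singleton] using hj
    simpa using hg

/-- A single gate reading only inputs is a well-formed program. [folklore] -/
theorem WF.singleton {g : Gate ι} (hg : GateOK 0 g) : WF [g] := by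
  simpa using WF.nil.append_singleton (gs := ([] : List (Gate ι))) hg

/-- The proof field `Circuit.wf` says exactly that the gate list is well formed. [folklore] -/
theorem wf_gates (C : Circuit ι) : WF C.gates := by
  intro j g hj a m ha
  obtain ⟨hjl, rfl⟩ := List.getElem?_eq_some_iff.1 hj
  exact C.wf j hjl a m ha

/-- A family of wires `ρ` into a program with `L` gates is valid if it only refers to gates
`< L`. [folklore] -/
def WiresOK (L : ℕ) (ρ : ι' → ι ⊕ ℕ) : Prop := ∀ i m, ρ i = .inr m → m < L

/-- Wires into the first `L` gates are wires into the first `L' ≥ L` gates. [folklore] -/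
theorem WiresOK.mono {L L' : ℕ} {ρ : ι' → ι ⊕ ℕ} (h : WiresOK L ρ) (hL : L ≤ L') :
    WiresOK L' ρ := fun i m hi => (h i m hi).trans_le hL

/-- Wires pointing at inputs only are always valid. [folklore] -/
theorem wiresOK_inl (L : ℕ) (e : ι' → ι) : WiresOK L (fun i => (Sum.inl (e i) : ι ⊕ ℕ)) :=
  fun _ _ h => by cases h

/-! ### Relocation of a gate list behind another one -/

/-- Re-wire a wire of a program over inputs `ι'` that is placed behind a program with `L`
gates over inputs `ι`: input `i'` becomes the wire `ρ i'`, gate `m` becomes gate `m + L`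
(Vollmer 1999, §1.2, composition of circuits). [cite: Vollmer1999, §1.2] -/
def shiftWire (ρ : ι' → ι ⊕ ℕ) (L : ℕ) : ι' ⊕ ℕ → ι ⊕ ℕ
  | .inl i => ρ i
  | .inr m => .inr (m + L)

/-- Relocate a gate behind a program with `L` gates, feeding its inputs from the wires `ρ`
(Vollmer 1999, §1.2). [cite: Vollmer1999, §1.2] -/
def reloc (ρ : ι' → ι ⊕ ℕ) (L : ℕ) (g : Gate ι') : Gate ι :=
  ⟨g.arity, g.op, fun a => shiftWire ρ L (g.args a)⟩

/-- Relocation does not change the gate function (arity and truth table). [folklore] -/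
@[simp] theorem reloc_fn (ρ : ι' → ι ⊕ ℕ) (L : ℕ) (g : Gate ι') : (reloc ρ L g).fn = g.fn := rfl

/-- A gate valid at position `j`, relocated behind `L` gates along valid wires, is valid at
position `L + j`. [folklore] -/
theorem GateOK.reloc {j L : ℕ} {g : Gate ι'} {ρ : ι' → ι ⊕ ℕ} (hg : GateOK j g)
    (hρ : WiresOK L ρ) : GateOK (L + j) (reloc ρ L g) := by
  intro a m ha
  simp only [GateList.reloc] at ha
  cases hw : g.args a with
  | inl i =>
    rw [hw] at ha
    exact (hρ i m ha).trans_le (Nat.le_add_right _ _)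
  | inr m' =>
    rw [hw] at ha
    simp only [shiftWire, Sum.inr.injEq] at ha
    have := hg a m' hw
    omega

/-- Appending a relocated well-formed program to a well-formed program is well formed
(Vollmer 1999, §1.2). [cite: Vollmer1999, §1.2] -/
theorem WF.append_reloc {gs : List (Gate ι)} {gs' : List (Gate ι')} {ρ : ι' → ι ⊕ ℕ}
    (h : WF gs) (h' : WF gs') (hρ : WiresOK gs.length ρ) :
    WF (gs ++ gs'.map (reloc ρ gs.length)) := by
  refine h.append fun j g hj => ?_
  rw [List.getElem?_map] at hj
  obtain ⟨g', hg', rfl⟩ := Option.map_eq_some_iff.1 hj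
  exact (h' j g' hg').reloc hρ

/-- Shifted output wires of the second program are valid wires of the combined program. [folklore] -/
theorem wiresOK_shiftWire {L L' : ℕ} {ρ : ι' → ι ⊕ ℕ} {out : κ → ι' ⊕ ℕ} (hρ : WiresOK L ρ)
    (hout : WiresOK L' out) : WiresOK (L + L') (fun k => shiftWire ρ L (out k)) := by
  intro k m hk
  change shiftWire ρ L (out k) = Sum.inr m at hk
  cases hw : out k with
  | inl i =>
    rw [hw] at hk
    exact (hρ i m hk).trans_le (Nat.le_add_right _ _)
  | inr m' =>
    rw [hw] at hk
    simp only [shiftWire, Sum.inr.injEq] at hk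
    have := hout k m' hw
    omega

/-- A wire into the first `vs.length` gates keeps its value when more gate values are
appended. [folklore] -/
theorem wireOf_append_of_lt (x : ι → Bool) (vs ws : List Bool) (w : ι ⊕ ℕ)
    (hw : ∀ m, w = .inr m → m < vs.length) : wireOf x (vs ++ ws) w = wireOf x vs w := by
  cases w with
  | inl i => rfl
  | inr m =>
    simp only [wireOf_inr, List.getD_eq_getElem?_getD]
    rw [List.getElem?_append_left (hw m rfl)]

/-- The value of a relocated wire: it reads the second program `ws` on the input assignment
given by the wires `ρ` into the first program `vs`. [folklore] -/
theorem wireOf_shiftWire (x : ι → Bool) (vs ws : List Bool) {L : ℕ} (hL : vs.length = L)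
    (ρ : ι' → ι ⊕ ℕ) (hρ : WiresOK L ρ) (w : ι' ⊕ ℕ) :
    wireOf x (vs ++ ws) (shiftWire ρ L w) = wireOf (fun i => wireOf x vs (ρ i)) ws w := by
  cases w with
  | inl i =>
    simp only [shiftWire, wireOf_inl]
    exact wireOf_append_of_lt x vs ws (ρ i) fun m hm => hL ▸ hρ i m hm
  | inr m =>
    simp only [shiftWire, wireOf_inr, List.getD_eq_getElem?_getD]
    rw [List.getElem?_append_right (by omega)]
    congr 2
    omega

/-- **Relocation lemma.** Appending to `gs` the program `gs'` relocated behind `gs` with input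
wires `ρ` computes first the values of `gs`, then the values of `gs'` on the assignment read off
the wires `ρ` (Vollmer 1999, §1.2, composition of circuits). [cite: Vollmer1999, §1.2] -/
theorem vals_append_reloc (gs : List (Gate ι)) (gs' : List (Gate ι')) (ρ : ι' → ι ⊕ ℕ)
    (hρ : WiresOK gs.length ρ) (x : ι → Bool) :
    vals (gs ++ gs'.map (reloc ρ gs.length)) x =
      vals gs x ++ vals gs' (fun i => wireOf x (vals gs x) (ρ i)) := by
  induction gs' using List.reverseRecOn with
  | nil => simp
  | append_singleton gs' g ih =>
    rw [List.map_append, List.map_singleton, ← List.append_assoc, vals_append_singleton, ih,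
      vals_append_singleton, List.append_assoc]
    show vals gs x ++ (vals gs' _ ++ [g.op _]) = vals gs x ++ (vals gs' _ ++ [g.op _])
    congr 3
    exact congrArg g.op (funext fun a => wireOf_shiftWire x _ _ (length_vals gs x) ρ hρ (g.args a))

/-! ### Realizing a multi-output Boolean map -/

/-- The gate list `gs` over the basis `B` with output wires `out` *realizes* the multi-output
map `f : (ι → Bool) → (κ → Bool)`: it is acyclic, all gates are from `B`, output wires exist,
and output wire `k` carries `f x k` (Arora–Barak 2009, Def. 6.1 for several outputs;
Vollmer 1999, Def. 1.6). [cite: Vollmer1999, Def. 1.6] -/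
structure Realizes (B : Set GateFn) (gs : List (Gate ι)) (out : κ → ι ⊕ ℕ)
    (f : (ι → Bool) → κ → Bool) : Prop where
  /-- acyclicity -/
  wf : WF gs
  /-- all gates are from the basis -/
  isOver : ∀ g ∈ gs, g.fn ∈ B
  /-- output wires refer to existing gates -/
  outOK : WiresOK gs.length out
  /-- output wire `k` carries `f x k` -/
  eval : ∀ x k, wireOf x (vals gs x) (out k) = f x k

end GateList

open GateList

/-- `CktSize B f s`: the multi-output Boolean map `f : (ι → Bool) → (κ → Bool)` is computed by a
straight-line program over the basis `B` with at most `s` gates (Vollmer 1999, Def. 1.6–1.7;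
Arora–Barak 2009, Def. 6.1). [cite: Vollmer1999, Def. 1.6–1.7] -/
def CktSize (B : Set GateFn) (f : (ι → Bool) → κ → Bool) (s : ℕ) : Prop :=
  ∃ (gs : List (Gate ι)) (out : κ → ι ⊕ ℕ), gs.length ≤ s ∧ Realizes B gs out f

namespace CktSize

variable {B : Set GateFn}

/-- Monotonicity in the size bound. [folklore] -/
theorem of_le {f : (ι → Bool) → κ → Bool} {s s' : ℕ} (h : CktSize B f s) (hs : s ≤ s') :
    CktSize B f s' := by
  obtain ⟨gs, out, hl, hR⟩ := h
  exact ⟨gs, out, hl.trans hs, hR⟩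

/-- Extensionally equal maps have the same circuits. [folklore] -/
theorem congr {f g : (ι → Bool) → κ → Bool} {s : ℕ} (h : CktSize B f s)
    (hfg : ∀ x k, f x k = g x k) : CktSize B g s := by
  obtain ⟨gs, out, hl, hR⟩ := h
  exact ⟨gs, out, hl, ⟨hR.wf, hR.isOver, hR.outOK, fun x k => (hR.eval x k).trans (hfg x k)⟩⟩

/-- Monotonicity in the basis. [folklore] -/
theorem basis_mono {B B' : Set GateFn} {f : (ι → Bool) → κ → Bool} {s : ℕ} (h : CktSize B f s)
    (hB : B ⊆ B') : CktSize B' f s := by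
  obtain ⟨gs, out, hl, hR⟩ := h
  exact ⟨gs, out, hl, ⟨hR.wf, fun g hg => hB (hR.isOver g hg), hR.outOK, hR.eval⟩⟩

/-- Projections (and re-orderings, duplications of inputs) cost nothing: no gates, output wires
pointing at inputs (Vollmer 1999, §1.1). [cite: Vollmer1999, §1.1] -/
theorem proj (B : Set GateFn) (π : κ → ι) : CktSize B (fun (x : ι → Bool) k => x (π k)) 0 :=
  ⟨[], fun k => .inl (π k), le_rfl,
    ⟨WF.nil, fun g hg => (by simp at hg), fun _ _ h => (by simp at h), fun _ _ => rfl⟩⟩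

/-- The identity map costs nothing. [folklore] -/
theorem id (B : Set GateFn) : CktSize B (fun (x : ι → Bool) => x) 0 := proj B _root_.id

/-- Renaming output wires is free. [folklore] -/
theorem outMap {f : (ι → Bool) → κ → Bool} {s : ℕ} (h : CktSize B f s) (r : κ' → κ) :
    CktSize B (fun x k' => f x (r k')) s := by
  obtain ⟨gs, out, hl, hR⟩ := h
  exact ⟨gs, fun k' => out (r k'), hl,
    ⟨hR.wf, hR.isOver, fun k' m hk => hR.outOK (r k') m hk, fun x k' => hR.eval x (r k')⟩⟩

/-- Renaming input variables is free (Vollmer 1999, §1.2, projection closure). [cite: Vollmer1999, §1.2] -/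
theorem rewire {f : (ι → Bool) → κ → Bool} {s : ℕ} (h : CktSize B f s) (e : ι → ι') :
    CktSize B (fun (x' : ι' → Bool) => f (fun i => x' (e i))) s := by
  obtain ⟨gs, out, hl, hR⟩ := h
  have hρ : WiresOK 0 (fun i => (Sum.inl (e i) : ι' ⊕ ℕ)) := wiresOK_inl _ e
  refine ⟨gs.map (reloc (fun i => Sum.inl (e i)) 0), fun k => shiftWire (fun i => Sum.inl (e i)) 0
    (out k), by simpa using hl, ⟨?_, ?_, ?_, ?_⟩⟩
  · simpa using WF.nil.append_reloc hR.wf hρ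
  · intro g hg
    obtain ⟨g', hg', rfl⟩ := List.mem_map.1 hg
    simpa using hR.isOver g' hg'
  · simpa using wiresOK_shiftWire hρ hR.outOK
  · intro x k
    have h1 := vals_append_reloc [] gs (fun i => (Sum.inl (e i) : ι' ⊕ ℕ)) hρ x
    simp only [List.nil_append, List.length_nil, vals_nil, wireOf_inl] at h1
    have h2 := wireOf_shiftWire (L := 0) x [] (vals gs fun i => x (e i)) rfl _ hρ (out k)
    simp only [List.nil_append, wireOf_inl] at h2
    rw [h1, h2, hR.eval]

/-- **Sequential composition**: if `f` has circuits of size `s` and `g` of size `s'`, then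
`g ∘ f` has circuits of size `s + s'` (Vollmer 1999, §1.2; Arora–Barak 2009, proof of
Thm. 6.6). [cite: Vollmer1999, §1.2] -/
theorem comp {f : (ι → Bool) → κ → Bool} {g : (κ → Bool) → μ → Bool} {s s' : ℕ}
    (hf : CktSize B f s) (hg : CktSize B g s') : CktSize B (fun x => g (f x)) (s + s') := by
  obtain ⟨gs, out, hl, hR⟩ := hf
  obtain ⟨gs', out', hl', hR'⟩ := hg
  refine ⟨gs ++ gs'.map (reloc out gs.length), fun m => shiftWire out gs.length (out' m),
    by simp; omega, ⟨hR.wf.append_reloc hR'.wf hR.outOK, ?_, ?_, ?_⟩⟩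
  · intro g' hg'
    rcases List.mem_append.1 hg' with h | h
    · exact hR.isOver g' h
    · obtain ⟨g'', hg'', rfl⟩ := List.mem_map.1 h
      simpa using hR'.isOver g'' hg''
  · simpa using wiresOK_shiftWire hR.outOK hR'.outOK
  · intro x m
    rw [vals_append_reloc gs gs' out hR.outOK x,
      wireOf_shiftWire x _ _ (length_vals gs x) out hR.outOK]
    have hy : (fun i => wireOf x (vals gs x) (out i)) = f x := funext (hR.eval x)
    rw [hy, hR'.eval]

/-- **Parallel composition**: bundling the outputs of two programs on the same inputs, sizes
add (Vollmer 1999, §1.2). [cite: Vollmer1999, §1.2] -/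
theorem pair {f : (ι → Bool) → κ → Bool} {g : (ι → Bool) → κ' → Bool} {s s' : ℕ}
    (hf : CktSize B f s) (hg : CktSize B g s') :
    CktSize B (fun x => Sum.elim (f x) (g x)) (s + s') := by
  obtain ⟨gs, out, hl, hR⟩ := hf
  obtain ⟨gs', out', hl', hR'⟩ := hg
  have hρ : WiresOK gs.length (fun i => (Sum.inl i : ι ⊕ ℕ)) := wiresOK_inl _ _root_.id
  refine ⟨gs ++ gs'.map (reloc (fun i => Sum.inl i) gs.length),
    Sum.elim out (fun k' => shiftWire (fun i => Sum.inl i) gs.length (out' k')),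
    by simp; omega, ⟨hR.wf.append_reloc hR'.wf hρ, ?_, ?_, ?_⟩⟩
  · intro g' hg'
    rcases List.mem_append.1 hg' with h | h
    · exact hR.isOver g' h
    · obtain ⟨g'', hg'', rfl⟩ := List.mem_map.1 h
      simpa using hR'.isOver g'' hg''
  · rintro (k | k') m hk
    · simp only [Sum.elim_inl] at hk
      have := hR.outOK k m hk
      simp; omega
    · simp only [Sum.elim_inr] at hk
      simpa using wiresOK_shiftWire hρ hR'.outOK k' m hk
  · rintro x (k | k')
    · simp only [Sum.elim_inl]
      rw [vals_append_reloc gs gs' _ hρ x, wireOf_append_of_lt _ _ _ _ (fun m hm =>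
        (length_vals gs x).symm ▸ hR.outOK k m hm), hR.eval]
    · simp only [Sum.elim_inr]
      rw [vals_append_reloc gs gs' _ hρ x, wireOf_shiftWire x _ _ (length_vals gs x) _ hρ]
      simp only [wireOf_inl]
      exact hR'.eval x k'

/-- A single gate from the basis, wired to inputs, costs one gate (Vollmer 1999, Def. 1.6). [cite: Vollmer1999, Def. 1.6] -/
theorem gate (g : GateFn) (hg : g ∈ B) (w : Fin g.1 → ι) :
    CktSize B (fun (x : ι → Bool) (_ : Unit) => g.2 fun a => x (w a)) 1 := by
  refine ⟨[⟨g.1, g.2, fun a => .inl (w a)⟩], fun _ => .inr 0, le_rfl, ⟨?_, ?_, ?_, ?_⟩⟩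
  · exact WF.singleton fun a m h => by simp at h
  · intro g' hg'
    rw [List.mem_singleton] at hg'
    subst hg'
    exact hg
  · intro _ m hm
    simp only [Sum.inr.injEq] at hm
    subst hm
    simp
  · intro x u
    simp [vals]

end CktSize

/-! ### Concrete gates over `B₂` -/

/-- The constant gates have fan-in `0 ≤ 2` (Vollmer 1999, §1.1). [cite: Vollmer1999, §1.1] -/
theorem const_mem_B2 (b : Bool) : GateFn.const b ∈ B2 := by simp [B2, GateFn.const]

/-- Negation has fan-in `1 ≤ 2` (Vollmer 1999, §1.1). [cite: Vollmer1999, §1.1] -/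
theorem not_mem_B2 : GateFn.not ∈ B2 := by simp [B2, GateFn.not]

/-- Binary conjunction is in `B₂` (Vollmer 1999, §1.1). [cite: Vollmer1999, §1.1] -/
theorem and_mem_B2 : GateFn.and 2 ∈ B2 := by simp [B2, GateFn.and]

/-- Binary disjunction is in `B₂` (Vollmer 1999, §1.1). [cite: Vollmer1999, §1.1] -/
theorem or_mem_B2 : GateFn.or 2 ∈ B2 := by simp [B2, GateFn.or]

/-- Constants cost one (arity-`0`) gate over `B₂` (Vollmer 1999, §1.1). [cite: Vollmer1999, §1.1] -/
theorem cktSize_const (ι : Type*) (b : Bool) :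
    CktSize B2 (fun (_ : ι → Bool) (_ : Unit) => b) 1 :=
  (CktSize.gate (B := B2) (ι := ι) (GateFn.const b) (const_mem_B2 b) Fin.elim0).congr
    fun _ _ => rfl

/-- Negating an input costs one gate over `B₂` (Vollmer 1999, §1.1). [cite: Vollmer1999, §1.1] -/
theorem cktSize_not (i : ι) : CktSize B2 (fun (x : ι → Bool) (_ : Unit) => !x i) 1 :=
  (CktSize.gate (B := B2) GateFn.not not_mem_B2 fun _ => i).congr fun _ _ => rfl

/-- The conjunction of two inputs costs one gate over `B₂` (Vollmer 1999, §1.1). [cite: Vollmer1999, §1.1] -/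
theorem cktSize_and (i j : ι) : CktSize B2 (fun (x : ι → Bool) (_ : Unit) => (x i && x j)) 1 :=
  (CktSize.gate (B := B2) (GateFn.and 2) and_mem_B2 ![i, j]).congr fun x _ => by
    simp only [GateFn.and, Fin.forall_fin_two, Matrix.cons_val_zero, Matrix.cons_val_one,
      Bool.decide_and, Bool.decide_eq_true]

/-- The disjunction of two inputs costs one gate over `B₂` (Vollmer 1999, §1.1). [cite: Vollmer1999, §1.1] -/
theorem cktSize_or (i j : ι) : CktSize B2 (fun (x : ι → Bool) (_ : Unit) => (x i || x j)) 1 :=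
  (CktSize.gate (B := B2) (GateFn.or 2) or_mem_B2 ![i, j]).congr fun x _ => by
    simp only [GateFn.or, Fin.exists_fin_two, Matrix.cons_val_zero, Matrix.cons_val_one,
      Bool.decide_or, Bool.decide_eq_true]

/-- The multiplexer `(c ∧ a) ∨ (¬c ∧ b)` on three given inputs costs `4` gates over `B₂`
(Shannon expansion step; Vollmer 1999, §1.2). [cite: Vollmer1999, §1.2] -/
theorem cktSize_mux (c a b : ι) :
    CktSize B2 (fun (x : ι → Bool) (_ : Unit) => (x c && x a || !x c && x b)) 4 := by
  -- stage 1: pass the inputs through and add `¬ c`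
  have h1 : CktSize B2 (fun (x : ι → Bool) => Sum.elim x (fun (_ : Unit) => !x c)) (0 + 1) :=
    (CktSize.id B2).pair (cktSize_not c)
  -- stage 2: the two conjunctions
  have h2 : CktSize B2 (fun (y : ι ⊕ Unit → Bool) =>
      Sum.elim (fun (_ : Unit) => (y (.inl c) && y (.inl a)))
        (fun (_ : Unit) => (y (.inr ()) && y (.inl b)))) (1 + 1) :=
    (cktSize_and _ _).pair (cktSize_and _ _)
  -- stage 3: the disjunction
  have h3 : CktSize B2 (fun (z : Unit ⊕ Unit → Bool) (_ : Unit) => (z (.inl ()) || z (.inr ())))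
      1 := cktSize_or _ _
  exact ((h1.comp h2).comp h3).congr fun x _ => by simp

/-! ### Bundling finitely many single-output programs -/

namespace CktSize

variable {B : Set GateFn}

/-- A map with no outputs costs nothing. [folklore] -/
theorem of_isEmpty [IsEmpty κ] (B : Set GateFn) (f : (ι → Bool) → κ → Bool) : CktSize B f 0 :=
  ⟨[], fun k => isEmptyElim k, le_rfl,
    ⟨WF.nil, fun g hg => (by simp at hg), fun k => isEmptyElim k, fun _ k => isEmptyElim k⟩⟩

/-- Bundling `M` single-output programs on the same inputs: sizes add (Vollmer 1999, §1.2). [cite: Vollmer1999, §1.2] -/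
theorem pi_fin {M : ℕ} {f : (ι → Bool) → Fin M → Bool} {s : Fin M → ℕ}
    (h : ∀ j, CktSize B (fun x (_ : Unit) => f x j) (s j)) : CktSize B f (∑ j, s j) := by
  induction M with
  | zero => simpa using of_isEmpty B f
  | succ M ih =>
    have h1 : CktSize B (fun x (j : Fin M) => f x j.castSucc) (∑ j : Fin M, s j.castSucc) :=
      ih fun j => h j.castSucc
    have h2 := h1.pair (h (Fin.last M))
    rw [Fin.sum_univ_castSucc]
    refine (h2.outMap fun j : Fin (M + 1) =>
      if hj : (j : ℕ) < M then Sum.inl ⟨j, hj⟩ else Sum.inr ()).congr fun x j => ?_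
    by_cases hj : (j : ℕ) < M
    · simp only [hj, ↓reduceDIte, Sum.elim_inl]
      rfl
    · simp only [hj, ↓reduceDIte, Sum.elim_inr]
      congr 1
      exact (Fin.eq_last_of_not_lt hj).symm

/-- Bundling finitely many single-output programs on the same inputs: sizes add
(Vollmer 1999, §1.2). [cite: Vollmer1999, §1.2] -/
theorem pi [Fintype κ] {f : (ι → Bool) → κ → Bool} {s : κ → ℕ}
    (h : ∀ k, CktSize B (fun x (_ : Unit) => f x k) (s k)) : CktSize B f (∑ k, s k) := by
  classical
  set e := Fintype.equivFin κ
  have h1 : CktSize B (fun x (j : Fin (Fintype.card κ)) => f x (e.symm j)) (∑ j, s (e.symm j)) :=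
    pi_fin fun j => h (e.symm j)
  have hs : ∑ j, s (e.symm j) = ∑ k, s k := Fintype.sum_equiv e.symm _ _ fun _ => rfl
  rw [hs] at h1
  exact (h1.outMap e).congr fun x k => by simp

/-- Bundling with a uniform bound: `card κ * s` gates (Vollmer 1999, §1.2). [cite: Vollmer1999, §1.2] -/
theorem pi_const [Fintype κ] {f : (ι → Bool) → κ → Bool} {s : ℕ}
    (h : ∀ k, CktSize B (fun x (_ : Unit) => f x k) s) : CktSize B f (Fintype.card κ * s) := by
  have := pi h
  simpa using this

/-! ### Iteration -/

/-- Iterating an endo-map `t` times costs `t * s` gates (Arora–Barak 2009, proof of Thm. 6.6: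
one layer per machine step). [cite: AroraBarakCC2009, Thm. 6.6] -/
theorem iterate {F : (κ → Bool) → κ → Bool} {s : ℕ} (h : CktSize B F s) :
    ∀ t : ℕ, CktSize B (F^[t]) (t * s)
  | 0 => by
    rw [Nat.zero_mul]
    exact (CktSize.id (ι := κ) B).congr fun _ _ => rfl
  | t + 1 => by
    have := (iterate h t).comp h
    rw [Nat.succ_mul]
    exact this.congr fun x k => by rw [Function.iterate_succ_apply']

end CktSize

/-! ### The universal bound: every function has a circuit -/

/-- The size bound of the Shannon-expansion circuit for an arbitrary `m`-variable Boolean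
function: `univBound 0 = 1`, `univBound (m+1) = 2 * univBound m + 4` (i.e. `5 · 2ᵐ - 4`)
(cf. Arora–Barak 2009, Claim 2.13; Vollmer 1999, §1.2). [cite: AroraBarakCC2009, Claim 2.13] -/
def univBound : ℕ → ℕ
  | 0 => 1
  | m + 1 => 2 * univBound m + 4

/-- The universal bound is positive. [folklore] -/
theorem univBound_pos (m : ℕ) : 0 < univBound m := by cases m <;> simp [univBound]

/-- The universal bound is monotone in the number of variables. [folklore] -/
theorem univBound_mono : Monotone univBound := by
  refine monotone_nat_of_le_succ fun m => ?_
  simp only [univBound]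
  omega

/-- **Every** Boolean function of `m` variables is computed by a `B₂`-circuit with at most
`univBound m` gates, by Shannon expansion on the first variable
`f x = (x₀ ∧ f (1, x')) ∨ (¬ x₀ ∧ f (0, x'))` (Arora–Barak 2009, Claim 2.13, in the weaker
form "size depending only on `m`"). [cite: AroraBarakCC2009, Claim 2.13] -/
theorem cktSize_univ_fin : ∀ (m : ℕ) (f : (Fin m → Bool) → Unit → Bool),
    CktSize B2 f (univBound m)
  | 0, f => (cktSize_const (Fin 0) (f Fin.elim0 ())).congr fun x u => by
      rw [Subsingleton.elim x Fin.elim0]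
  | m + 1, f => by
    -- the two cofactors, as functions of all `m + 1` variables (ignoring `x 0`)
    have hc : ∀ b : Bool, CktSize B2 (fun (x : Fin (m + 1) → Bool) (u : Unit) =>
        f (Fin.cons b fun i => x i.succ) u) (univBound m) := fun b =>
      (cktSize_univ_fin m fun x' => f (Fin.cons b x')).rewire Fin.succ
    have h1 : CktSize B2 (fun (x : Fin (m + 1) → Bool) =>
        Sum.elim x (Sum.elim (fun u => f (Fin.cons true fun i => x i.succ) u)
          (fun u => f (Fin.cons false fun i => x i.succ) u)))
        (0 + (univBound m + univBound m)) :=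
      (CktSize.id B2).pair ((hc true).pair (hc false))
    have h2 := h1.comp (cktSize_mux (ι := Fin (m + 1) ⊕ (Unit ⊕ Unit))
      (.inl 0) (.inr (.inl ())) (.inr (.inr ())))
    refine (h2.of_le (by simp [univBound]; omega)).congr fun x u => ?_
    obtain ⟨⟩ := u
    induction x using Fin.consCases with
    | _ b y => cases b <;> simp

/-- Every Boolean function on a finite set `ι` of variables is computed by a `B₂`-circuit of
size at most `univBound (card ι)` (Arora–Barak 2009, Claim 2.13). [cite: AroraBarakCC2009, Claim 2.13] -/
theorem cktSize_univ [Fintype ι] (f : (ι → Bool) → Unit → Bool) :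
    CktSize B2 f (univBound (Fintype.card ι)) := by
  classical
  set e := Fintype.equivFin ι
  exact ((cktSize_univ_fin (Fintype.card ι) fun x' => f fun i => x' (e i)).rewire e.symm).congr
    fun x u => by simp

/-! ### From gate lists back to `Circuit` -/

/-- A single-output realization over `B` of size `≤ s` is a genuine `Circuit ι` over `B` with at
most `s` gates computing the function (Arora–Barak 2009, Rem. 6.4: straight-line programs are
circuits). [cite: AroraBarakCC2009, Rem. 6.4] -/
theorem CktSize.toCircuit {B : Set GateFn} {f : (ι → Bool) → Unit → Bool} {s : ℕ}
    (h : CktSize B f s) :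
    ∃ C : Circuit ι, C.IsOver B ∧ C.size ≤ s ∧ ∀ x, C.eval x = f x () := by
  obtain ⟨gs, out, hl, hR⟩ := h
  suffices ∀ (o : ι ⊕ ℕ) (ho : ∀ m, o = .inr m → m < gs.length),
      (∀ x, wireOf x (vals gs x) o = f x ()) →
        ∃ C : Circuit ι, C.IsOver B ∧ C.size ≤ s ∧ ∀ x, C.eval x = f x () from
    this (out ()) (hR.outOK ()) fun x => hR.eval x ()
  intro o ho hev
  refine ⟨⟨gs, o, fun j hj a m ha => hR.wf j _ (List.getElem?_eq_getElem hj) a m ha, ho⟩,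
    hR.isOver, hl, fun x => ?_⟩
  cases o with
  | inl i => exact hev x
  | inr m => exact hev x

end Literature.Computability.Complexity
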